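import Summits.QuantumFields.YangMills.Theorems.BalabanUVNodesN18HLayerW1Thickened
import Literature.MathematicalPhysics.QuantumFieldTheory.Balaban1983to89.Node00.RateRecordW1MapsAdm

/-!
# BalabanUVNodes ∕ N18 — THE INDUCTION ON THE LEVEL IN THE CONFIGURATION DIRECTION: [I] Theorem 1's printed inductive structure AT W1's OBJECT —
# ONE displayed one-step schema «(1.18) ∧ analyticity on the space tables at the levels `j ≤ k` ⟹ the step-`k` H-layer pair» ⟹ (1.18), [I] p. 263
# analyticity and (1.17) at EVERY level, the H-layer pair at EVERY step, L05 ∕ L06 at any level pairing and AT THE ADMISSIBLE PAIRING OF RECORD with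
# no embedding clause (Track A, DAG node N18 = NE5 `T4OutputRate.NE5 EA EB W κ θ C₅` :211; cluster K4 «SpineRates»; file 15 of seat
# pub-ymgap-dag-n18-c, row s1 «the H-layer ACTIVITY DATUM: instance + estimate», generation 4)

Cell `pub-ymgap`, HUMAN RULING D-0062 (Track A), R134 ACCELERATION seat `pub-ymgap-dag-n18-c` (strategy s1), generation 4.  THEOREMS ONLY (no `def`, no
`instance`, no `sorry`); imports file 13 `…N18HLayerW1Thickened` (p478698; through it files 10 `…N18HLayerW1ConfigRecord` p474817 and 9
`…N18HLayerW1Config` p470180) and the admissible-slot pin `Node00/RateRecordW1MapsAdm` (p481475, typed by dag-n22-c, filed by node00-def-W1);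
restates nothing.

WHY.  Files 9 ∕ 10 ∕ 12 ∕ 13 take the per-step H-layer pair of W1's towers — `(S k).AnalyticH` ((2.13an), [II] p. 15) and `(S k).Bound238` (Lemma 3 (2.38)
p. 20), or at LEVEL T the termwise (2.26) data — UNCONDITIONALLY AT EVERY STEP, and turn them into [I]'s (1.18), p. 263 analyticity and (1.17) for the
whole tower.  Print does not have them unconditionally.  [I] Theorem 1 is proved BY INDUCTION ON THE STEP: [II] proves the step-`k` data FROM the
inductive assumptions — (1.17)–(1.18) and «analytic on U^c_j(X, α₀, α₁)» — for the OLDER terms `E^{(j)}`, `j ≤ k` ([II] p. 1 «It is proved that the terms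
of the expansion satisfy the inductive assumptions»; p. 11 «with the analyticity properties and bounds slightly better than demanded by the inductive
assumption»; p. 15 «This is the analyticity statement in the inductive assumptions»; (2.15)–(2.26) pp. 15–17 estimate the generic term (2.14) through
`|V_k(Y, ·)|` and (1.42)–(1.43), i.e. through the old terms; p. 22 «completes the proof of the inductive assumptions for the action A_{k+1}, hence the proof
of Theorem 1.3»), and the induction closes with the amplitude renewal «O(1)C₃ε₁ ≤ E₀» ((2.41) p. 21).  So the deliverable of N10 ∕ NODE A (Lemmas 1–3 for
THE terms of record) has the CONDITIONAL shape
  «(1.18) with letters `(E₀, r₁)` and analyticity on the tables `sp j` at the levels `j ≤ k`, for every history of `W`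
     ⟹ `(S k).AnalyticH (Wk k) (sp (k+1))` ∧ `(S k).Bound238 (Wk k) (sp (k+1)) A R`»                                                    (STEP)
and THIS FILE runs [I] Theorem 1's induction AT THE OBJECT with (STEP) as the ONE displayed schema (an inline hypothesis, asserted nowhere): by strong
induction on the level, file 10's per-level tool `analyticOnNhd_and_bound_E_of_bound238_table_four` (neighbourhood extension + NE1′ at `Φ := CPair`, ANY
restriction-closed table, STRICT [KP86] clause) and the renewal `e·9·64·K₀(64,8)²·A ≤ E₀` give both inductive assumptions at the next level.

WHAT (theorems only; `F.P K` with the d = 4 numerals of files 9–10: rate clause `r₁ + 2·64·log 162 + 2 ≤ R`, STRICT clause `A·e^{5r₁+1}·K₀(64,8)·9·64 < 1`).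
* §1 THE INDUCTION.  `inductiveAssumptions_of_inductiveStep` — (STEP) + `W1.SpRestr` at every positive level + prefixes of `W` in `Wk k` + the clauses +
  the renewal ⟹ for every `n`, (1.18)`(E₀, r₁)` and analyticity on `sp j X` at all levels `j ≤ n` (level 0: no term, [I] (0.23); level `n+1`: (STEP) at
  `n` fed with the induction hypothesis, then file 10); packaged: ★ `hLayer_all_of_inductiveStep` (the H-layer pair AT EVERY STEP — what files 9–13 and
  dag-n18-d's junctions take as `han` ∕ `h238`), ★ `termBound118_of_inductiveStep` (`W1.TermBound118 S W sp E₀ r₁` — (1.18) ITSELF for the whole tower),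
  `termBound118_sharp_of_inductiveStep` (amplitude `e·9·64·K₀²·A`), ★ `termAnalytic_of_inductiveStep` (`W1.TermAnalytic S W sp` — [I] p. 263).
* §2 (1.17) AT THE TABLE from (STEP) ON ITS `ρ`-THICKENING: `termDerivBound_of_inductiveStep_thickening` — §1 on the thickened (restriction-closed) table
  family, then file 13's `termDerivBound_of_bound238_thickening` (Cauchy on the margin `Metric.ball_subset_thickening`): `W1.TermDerivBound S W sp
  (e·9·64·K₀²·A ∕ ρ) r₁` — all three printed inductive assumptions from the one schema.
* §3 L05 ∕ L06.  `decayBound_EA_of_inductiveStep` ∕ `decayBound_EB_of_inductiveStep` at ANY `R : W1.LevelPairing` (embedding clauses `hembA` ∕ `hembB`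
  and the pairing clause `hpair` displayed, as in file 10); ★ `decayBound_EA_ofRecordAdm_of_inductiveStep` ∕ ★ `decayBound_EB_ofRecordAdm_of_inductiveStep`
  AT THE ADMISSIBLE PAIRING OF RECORD `LevelPairing.ofRecordAdm F M N k sp gauge hg T₀ hT₀`: NO embedding clause (the readings lie in the spaces BY
  TYPE, `LevelPairing.ofRecordAdm_embA_mem` ∕ `_embB_mem`) and NO pairing clause (`W1.dj_pairOfRecord`): L05 ∕ L06 of the END at the admissible reading
  from (STEP) + the table's restriction property + numerics ALONE.
* §4 RIDERS.  `inductiveStep_of_unconditional` — file 10's unconditional per-step data give (STEP) trivially (so §1 GENERALISES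
  `termBound118_of_bound238_table` ∕ `termAnalytic_of_bound238_table`); `inductiveStep_termlessTower` — (STEP) is satisfiable (A5): W1's termless MODEL
  tower carries it for every `A ≥ 0` (junk-shaped witness, labelled so — ref-H WATCH-W1-DEGENERATE).
The LEVEL-T form of the schema (the inductive assumptions ⟹ (2.14) termwise analyticity + domination + (2.26) per term, N10's currency, through file 12's
Lemma-3 socket) is the companion module `…N18HLayerW1InductionTerms`.

HONEST FRAMING — what this is NOT.  Count-neutral by-name knit AT THE OBJECT; NOT a discharge of N18 (typed 28∕28 · discharged 5∕27 UNCHANGED).  (STEP) is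
DISPLAYED and asserted nowhere: it is [II]'s content for THE (2.14) terms of record (N10's Lemmas 1–3 ∕ NODE A's majorant) in its printed CONDITIONAL
form; the towers `S`, the tables `sp`, the history sets and the letters are data.  Dag-n22-c's `…N22W1StripInduction` (p45xxxx lineage) is the induction
on the young-coupling STRIP (one coupling complexified, S25 at `P := ℂ`, inductive datum = strip bounds, no configuration analyticity) — a different
inductive datum and tool; node00-def-W1's `analyticInEach_recTerm` (`Node00/HistoryRecursionOfRecord`) is the coupling-analyticity induction on generated
towers — disjoint.  NE5 (the η-rate, two-run content) untouched: NOT IN PRINT, NOT PROVED.  One finite four-torus programme at fixed `ε`, Bałaban as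
printed — NOT the continuum limit on ℝ⁴, NOT infinite volume, NOT OS, NOT a mass gap, NOT Clay.  0 `sorry`, 0 `def`; axioms standard.

References (TYPES ∕ loci only): [I] = [Balaban1987RG1] T. Bałaban, Commun. Math. Phys. **109** (1987) 249–301 — (0.23) p. 256, (0.24)–(0.25) p. 257,
Thm 1 p. 259, (1.17)–(1.18) and the analyticity sentence p. 263; [II] = [Balaban1988RG2Cluster] T. Bałaban, Commun. Math. Phys. **116** (1988) 1–22 —
Abstract p. 1, p. 11, (2.13)–(2.14) pp. 14–15, the analyticity statement p. 15, (2.15)–(2.26) pp. 15–17, Lemma 3 (2.38) p. 20, (2.39)–(2.41) p. 21, p. 22;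
[KoteckyPreiss1986] R. Kotecký–D. Preiss, Commun. Math. Phys. **103** (1986), Thm 1 p. 492.  Nothing here is a claim about the Yang–Mills mass gap.
-/

noncomputable section

namespace Summit.QuantumFields.YangMills.BalabanUVNodes.N18HLayerW1Induction

open Set Metric
open scoped BigOperators
open Literature.MathematicalPhysics.QuantumFieldTheory.Balaban1983to89
open Literature.MathematicalPhysics.QuantumFieldTheory.Balaban1983to89.T4Continuum (T4Family)
open Literature.MathematicalPhysics.QuantumFieldTheory.Balaban1983to89.T4OutputRate
open Literature.MathematicalPhysics.QuantumFieldTheory.Balaban1983to89.B12TreeDecay (K₀)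
open Literature.MathematicalPhysics.QuantumFieldTheory.Balaban1983to89.Node00
open Literature.MathematicalPhysics.QuantumFieldTheory.Balaban1983to89.Node00.Sect2 (domSys CPair ofBackgroundC)
open Literature.MathematicalPhysics.QuantumFieldTheory.Balaban1983to89.Node00.W1
open Summit.QuantumFields.YangMills.BalabanUVNodes.N18HLayerW1Config (analyticH_termlessTower bound238_termlessTower)
open Summit.QuantumFields.YangMills.BalabanUVNodes.N18HLayerW1ConfigRecord (analyticOnNhd_and_bound_E_of_bound238_table_four
  termBound118_of_bound238_table decayBound_EA_of_bound238_table decayBound_EB_of_bound238_table)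
open Summit.QuantumFields.YangMills.BalabanUVNodes.N18HLayerW1Thickened (spRestr_thickening termDerivBound_of_bound238_thickening)

/-! ## §1 THE INDUCTION ON THE LEVEL: (STEP) ⟹ both inductive assumptions at every level, the H-layer pair at every step -/

section Induction

variable (F : T4Family) (K : ℕ) {𝔸 : Type*} [NormedRing 𝔸] [NormedAlgebra ℂ 𝔸] {M : ℕ}

open Classical in
/-- **[I] THEOREM 1's INDUCTION AT W1's OBJECT, CONFIGURATION DIRECTION.**  For W1's tower `S` on the record's torus `F.P K`, a history set `W` with prefixes in
`Wk k`, a space-table family `sp` with the restriction property of [II] p. 15 at every positive level (ANY such family — the table of record qualifies; no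
openness): IF the ONE-STEP SCHEMA (STEP) holds — for every step `k`, (1.18) with letters `(E₀, r₁)` and [I] p. 263 analyticity ON THE TABLES at all levels
`j ≤ k` for every history of `W` IMPLY the step-`k` H-layer pair `(S k).AnalyticH (Wk k) (sp (k+1))` ((2.13an)) ∧ `(S k).Bound238 (Wk k) (sp (k+1)) A R`
((2.38)) ([II] pp. 15–22 for the terms of record; DISPLAYED) — THEN, under the located rate clause, the STRICT [KP86] clause and the amplitude renewal
`e·9·64·K₀(64,8)²·A ≤ E₀` ([II] (2.41) «O(1)C₃ε₁ ≤ E₀»), BOTH INDUCTIVE ASSUMPTIONS HOLD AT ALL LEVELS `j ≤ n`, for every `n`: `‖E^{(j)}(X; g; φ)‖ ≤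
E₀·e^{−r₁ d_j(X)}` and `E^{(j)}(X; g; ·)` analytic at every point of `sp j X`.  Strong induction on `n`: level `0` carries no term ([I] (0.23)); at level
`n+1`, (STEP) at `n` fed with the induction hypothesis gives the step-`n` pair, and file 10's `analyticOnNhd_and_bound_E_of_bound238_table_four` (the
neighbourhood extension + NE1′ at `Φ := CPair` + [Chae1985], on ANY restriction-closed table) gives (2.39)–(2.41) and the analyticity of `E^{(n+1)}(X; g; ·) =
termC S (n+1) X g` ((2.13) definitional in W1, `termC_succ`), the renewal reading the amplitude back at `E₀`.
[cite: Balaban1987RG1, Thm 1 p.259 and (1.18) p.263; Balaban1988RG2Cluster, p.1 (Abstract), p.15 (analyticity statement), Lemma 3 (2.38) p.20, (2.41) p.21, p.22] -/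
theorem inductiveAssumptions_of_inductiveStep (S : ClusterTower (F.P K) 𝔸 M) (W : Set (ℕ → ℝ)) (Wk : (k : ℕ) → Set (Fin (k + 1) → ℝ))
    (sp : (j : ℕ) → (domSys (F.P K) M j).Dom → Set (CPair (F.P K) 𝔸)) {A R r₁ E₀ : ℝ}
    (hW : ∀ k, ∀ g ∈ W, restrictPrefix k g ∈ Wk k) (hrestr : ∀ k, W1.SpRestr (sp (k + 1)))
    (hstep : ∀ k : ℕ,
      (∀ g ∈ W, ∀ j ≤ k, ∀ (X : (domSys (F.P K) M j).Dom), ∀ φ ∈ sp j X,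
          ‖termC S j X g φ‖ ≤ E₀ * Real.exp (-(r₁ * (domSys (F.P K) M j).dj X))) →
      (∀ g ∈ W, ∀ j ≤ k, ∀ (X : (domSys (F.P K) M j).Dom), AnalyticOnNhd ℂ (termC S j X g) (sp j X)) →
      (S k).AnalyticH (Wk k) (sp (k + 1)) ∧ (S k).Bound238 (Wk k) (sp (k + 1)) A R)
    (hA : 0 ≤ A) (hr₁ : 0 ≤ r₁) (hrate : r₁ + 2 * (64 * Real.log 162) + 2 ≤ R)
    (hsmall : A * Real.exp (5 * r₁ + 1) * K₀ 64 8 * 9 * 64 < 1) (hrenew : Real.exp 1 * 9 * 64 * K₀ 64 8 ^ 2 * A ≤ E₀) :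
    ∀ n : ℕ,
      (∀ g ∈ W, ∀ j ≤ n, ∀ (X : (domSys (F.P K) M j).Dom), ∀ φ ∈ sp j X,
          ‖termC S j X g φ‖ ≤ E₀ * Real.exp (-(r₁ * (domSys (F.P K) M j).dj X))) ∧
      (∀ g ∈ W, ∀ j ≤ n, ∀ (X : (domSys (F.P K) M j).Dom), AnalyticOnNhd ℂ (termC S j X g) (sp j X)) := by
  have hM : 0 ≤ Real.exp 1 * 9 * 64 * K₀ 64 8 ^ 2 * A := by positivity
  have hE₀ : 0 ≤ E₀ := le_trans hM hrenew
  intro n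
  induction n with
  | zero =>
    refine ⟨fun g _ j hj X φ _ => ?_, fun g _ j hj X => ?_⟩
    · obtain rfl : j = 0 := Nat.le_zero.mp hj
      rw [termC_zero, norm_zero]
      positivity
    · obtain rfl : j = 0 := Nat.le_zero.mp hj
      exact analyticOnNhd_const
  | succ n ih =>
    obtain ⟨hB, hAn⟩ := ih
    -- (STEP) at step `n`, fed with the induction hypothesis: the step-`n` H-layer pair on `sp (n+1)`
    obtain ⟨han, h238⟩ := hstep n hB hAn
    -- file 10: (2.39)–(2.41) and the analyticity of `E^{(n+1)}(X; g; ·)` on `sp (n+1) X`, any restriction-closed table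
    have key := analyticOnNhd_and_bound_E_of_bound238_table_four F K (S n) (Wk n) (sp (n + 1)) (hrestr n) han h238 hA hr₁
      hrate hsmall
    refine ⟨fun g hg j hj X φ hφ => ?_, fun g hg j hj X => ?_⟩
    · rcases Nat.of_le_succ hj with h | rfl
      · exact hB g hg j h X φ hφ
      · -- level `n+1`: (2.41) at amplitude `e·9·64·K₀²·A`, renewed to `E₀`
        rw [termC_succ]
        exact ((key (restrictPrefix n g) (hW n g hg) X).2 φ hφ).trans
          (mul_le_mul_of_nonneg_right hrenew (Real.exp_nonneg _))
    · rcases Nat.of_le_succ hj with h | rfl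
      · exact hAn g hg j h X
      · exact (key (restrictPrefix n g) (hW n g hg) X).1

open Classical in
/-- **THE H-LAYER PAIR AT EVERY STEP FROM (STEP)** — what files 9–13 and dag-n18-d's junctions (`…N18AtReadingOfRecord12Levels` §1, `…N18AtReadingOnTables`)
take as their per-step hypotheses `han ∕ h238 : ∀ k, …`: for every `k`, `(S k).AnalyticH (Wk k) (sp (k+1)) ∧ (S k).Bound238 (Wk k) (sp (k+1)) A R` — (STEP)
at `k` fed with §1's inductive assumptions at the levels `≤ k`. [cite: Balaban1988RG2Cluster, p.15 (analyticity statement) and Lemma 3 (2.38) p.20; Balaban1987RG1, Thm 1 p.259] -/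
theorem hLayer_all_of_inductiveStep (S : ClusterTower (F.P K) 𝔸 M) (W : Set (ℕ → ℝ)) (Wk : (k : ℕ) → Set (Fin (k + 1) → ℝ))
    (sp : (j : ℕ) → (domSys (F.P K) M j).Dom → Set (CPair (F.P K) 𝔸)) {A R r₁ E₀ : ℝ}
    (hW : ∀ k, ∀ g ∈ W, restrictPrefix k g ∈ Wk k) (hrestr : ∀ k, W1.SpRestr (sp (k + 1)))
    (hstep : ∀ k : ℕ,
      (∀ g ∈ W, ∀ j ≤ k, ∀ (X : (domSys (F.P K) M j).Dom), ∀ φ ∈ sp j X,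
          ‖termC S j X g φ‖ ≤ E₀ * Real.exp (-(r₁ * (domSys (F.P K) M j).dj X))) →
      (∀ g ∈ W, ∀ j ≤ k, ∀ (X : (domSys (F.P K) M j).Dom), AnalyticOnNhd ℂ (termC S j X g) (sp j X)) →
      (S k).AnalyticH (Wk k) (sp (k + 1)) ∧ (S k).Bound238 (Wk k) (sp (k + 1)) A R)
    (hA : 0 ≤ A) (hr₁ : 0 ≤ r₁) (hrate : r₁ + 2 * (64 * Real.log 162) + 2 ≤ R)
    (hsmall : A * Real.exp (5 * r₁ + 1) * K₀ 64 8 * 9 * 64 < 1) (hrenew : Real.exp 1 * 9 * 64 * K₀ 64 8 ^ 2 * A ≤ E₀) :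
    ∀ k, (S k).AnalyticH (Wk k) (sp (k + 1)) ∧ (S k).Bound238 (Wk k) (sp (k + 1)) A R := fun k =>
  hstep k (inductiveAssumptions_of_inductiveStep F K S W Wk sp hW hrestr hstep hA hr₁ hrate hsmall hrenew k).1
    (inductiveAssumptions_of_inductiveStep F K S W Wk sp hW hrestr hstep hA hr₁ hrate hsmall hrenew k).2

open Classical in
/-- **(1.18) ITSELF FOR THE WHOLE TOWER FROM (STEP)**: `W1.TermBound118 S W sp E₀ r₁` — «|E^{(j)}(X; g; 𝐔, 𝐉)| ≤ E₀ exp(−κ d_j(X)) for all configurations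
(𝐔, 𝐉) ∈ U^c_j» at every level, every history of `W`, every domain, every configuration of the table — [I] Theorem 1's conclusion (1.18) by its own
induction, modulo the displayed step. [cite: Balaban1987RG1, (1.18) p.263 and Thm 1 p.259; Balaban1988RG2Cluster, (2.41) p.21 and p.22] -/
theorem termBound118_of_inductiveStep (S : ClusterTower (F.P K) 𝔸 M) (W : Set (ℕ → ℝ)) (Wk : (k : ℕ) → Set (Fin (k + 1) → ℝ))
    (sp : (j : ℕ) → (domSys (F.P K) M j).Dom → Set (CPair (F.P K) 𝔸)) {A R r₁ E₀ : ℝ}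
    (hW : ∀ k, ∀ g ∈ W, restrictPrefix k g ∈ Wk k) (hrestr : ∀ k, W1.SpRestr (sp (k + 1)))
    (hstep : ∀ k : ℕ,
      (∀ g ∈ W, ∀ j ≤ k, ∀ (X : (domSys (F.P K) M j).Dom), ∀ φ ∈ sp j X,
          ‖termC S j X g φ‖ ≤ E₀ * Real.exp (-(r₁ * (domSys (F.P K) M j).dj X))) →
      (∀ g ∈ W, ∀ j ≤ k, ∀ (X : (domSys (F.P K) M j).Dom), AnalyticOnNhd ℂ (termC S j X g) (sp j X)) →
      (S k).AnalyticH (Wk k) (sp (k + 1)) ∧ (S k).Bound238 (Wk k) (sp (k + 1)) A R)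
    (hA : 0 ≤ A) (hr₁ : 0 ≤ r₁) (hrate : r₁ + 2 * (64 * Real.log 162) + 2 ≤ R)
    (hsmall : A * Real.exp (5 * r₁ + 1) * K₀ 64 8 * 9 * 64 < 1) (hrenew : Real.exp 1 * 9 * 64 * K₀ 64 8 ^ 2 * A ≤ E₀) :
    TermBound118 S W sp E₀ r₁ := fun g hg j X φ hφ =>
  (inductiveAssumptions_of_inductiveStep F K S W Wk sp hW hrestr hstep hA hr₁ hrate hsmall hrenew j).1 g hg j le_rfl X φ hφ

open Classical in
/-- **(1.18) AT THE SHARP AMPLITUDE `e·9·64·K₀(64,8)²·A`** ((2.41)'s `O(1)C₃ε₁`): once the induction has run, every step's pair holds and file 10's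
`termBound118_of_bound238_table` applies verbatim. [cite: Balaban1988RG2Cluster, (2.41) p.21; Balaban1987RG1, (1.18) p.263] -/
theorem termBound118_sharp_of_inductiveStep (S : ClusterTower (F.P K) 𝔸 M) (W : Set (ℕ → ℝ)) (Wk : (k : ℕ) → Set (Fin (k + 1) → ℝ))
    (sp : (j : ℕ) → (domSys (F.P K) M j).Dom → Set (CPair (F.P K) 𝔸)) {A R r₁ E₀ : ℝ}
    (hW : ∀ k, ∀ g ∈ W, restrictPrefix k g ∈ Wk k) (hrestr : ∀ k, W1.SpRestr (sp (k + 1)))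
    (hstep : ∀ k : ℕ,
      (∀ g ∈ W, ∀ j ≤ k, ∀ (X : (domSys (F.P K) M j).Dom), ∀ φ ∈ sp j X,
          ‖termC S j X g φ‖ ≤ E₀ * Real.exp (-(r₁ * (domSys (F.P K) M j).dj X))) →
      (∀ g ∈ W, ∀ j ≤ k, ∀ (X : (domSys (F.P K) M j).Dom), AnalyticOnNhd ℂ (termC S j X g) (sp j X)) →
      (S k).AnalyticH (Wk k) (sp (k + 1)) ∧ (S k).Bound238 (Wk k) (sp (k + 1)) A R)
    (hA : 0 ≤ A) (hr₁ : 0 ≤ r₁) (hrate : r₁ + 2 * (64 * Real.log 162) + 2 ≤ R)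
    (hsmall : A * Real.exp (5 * r₁ + 1) * K₀ 64 8 * 9 * 64 < 1) (hrenew : Real.exp 1 * 9 * 64 * K₀ 64 8 ^ 2 * A ≤ E₀) :
    TermBound118 S W sp (Real.exp 1 * 9 * 64 * K₀ 64 8 ^ 2 * A) r₁ :=
  have hall := hLayer_all_of_inductiveStep F K S W Wk sp hW hrestr hstep hA hr₁ hrate hsmall hrenew
  termBound118_of_bound238_table F K S W Wk sp hW hrestr (fun k => (hall k).1) (fun k => (hall k).2) hA hr₁ hrate hsmall

open Classical in
/-- **[I] p. 263 ANALYTICITY FOR THE WHOLE TOWER FROM (STEP)**: `W1.TermAnalytic S W sp` — «E^{(j)}(X, g_{j−1}, 𝐔, 𝐉) is defined and analytic on the space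
U^c_j(X, α₀, α₁)» at every level (the second inductive assumption, by the same induction). [cite: Balaban1987RG1, §1 p.263 (analytic on U^c_j) and Thm 1 p.259; Balaban1988RG2Cluster, p.15 (analyticity statement)] -/
theorem termAnalytic_of_inductiveStep (S : ClusterTower (F.P K) 𝔸 M) (W : Set (ℕ → ℝ)) (Wk : (k : ℕ) → Set (Fin (k + 1) → ℝ))
    (sp : (j : ℕ) → (domSys (F.P K) M j).Dom → Set (CPair (F.P K) 𝔸)) {A R r₁ E₀ : ℝ}
    (hW : ∀ k, ∀ g ∈ W, restrictPrefix k g ∈ Wk k) (hrestr : ∀ k, W1.SpRestr (sp (k + 1)))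
    (hstep : ∀ k : ℕ,
      (∀ g ∈ W, ∀ j ≤ k, ∀ (X : (domSys (F.P K) M j).Dom), ∀ φ ∈ sp j X,
          ‖termC S j X g φ‖ ≤ E₀ * Real.exp (-(r₁ * (domSys (F.P K) M j).dj X))) →
      (∀ g ∈ W, ∀ j ≤ k, ∀ (X : (domSys (F.P K) M j).Dom), AnalyticOnNhd ℂ (termC S j X g) (sp j X)) →
      (S k).AnalyticH (Wk k) (sp (k + 1)) ∧ (S k).Bound238 (Wk k) (sp (k + 1)) A R)
    (hA : 0 ≤ A) (hr₁ : 0 ≤ r₁) (hrate : r₁ + 2 * (64 * Real.log 162) + 2 ≤ R)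
    (hsmall : A * Real.exp (5 * r₁ + 1) * K₀ 64 8 * 9 * 64 < 1) (hrenew : Real.exp 1 * 9 * 64 * K₀ 64 8 ^ 2 * A ≤ E₀) :
    TermAnalytic S W sp := fun g hg j X =>
  (inductiveAssumptions_of_inductiveStep F K S W Wk sp hW hrestr hstep hA hr₁ hrate hsmall hrenew j).2 g hg j le_rfl X

end Induction

/-! ## §2 (1.17) AT THE TABLE from (STEP) on its `ρ`-thickening — all three printed inductive assumptions from the one schema -/

section Seventeen

variable (F : T4Family) (K : ℕ) {𝔸 : Type*} [NormedRing 𝔸] [NormedAlgebra ℂ 𝔸] {M : ℕ}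

open Classical in
/-- **(1.17) AT THE TABLE ITSELF FROM (STEP) ON ITS `ρ`-THICKENING** ([I] p. 263: the configurations with the smaller constants lie inside `U^c_j(X, α₀, α₁)`
— the Cauchy margin).  IF (STEP) holds for the THICKENED table family `j X ↦ thickening ρ (sp j X)` (radius `ρ > 0`; the thickened family inherits the
restriction property, file 13's `spRestr_thickening`), THEN §1 gives the H-layer pair at every step on the thickened tables and file 13's
`termDerivBound_of_bound238_thickening` (n22-c's per-term Cauchy face, margin `Metric.ball_subset_thickening`) gives `W1.TermDerivBound S W sp
(e·9·64·K₀(64,8)²·A ∕ ρ) r₁` — `‖∂_{(𝐔,𝐉)} E^{(j)}(X; g; ·)‖ ≤ (E₀′∕ρ)·e^{−r₁ d_j(X)}` on `sp j X` — next to §1's (1.18) and analyticity on the thickened (hence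
on the inner) tables: the three inductive assumptions of [I] p. 263 from the one displayed step. [cite: Balaban1987RG1, (1.17)-(1.18) p.263 and Thm 1 p.259; Balaban1988RG2Cluster, p.22] -/
theorem termDerivBound_of_inductiveStep_thickening (S : ClusterTower (F.P K) 𝔸 M) (W : Set (ℕ → ℝ)) (Wk : (k : ℕ) → Set (Fin (k + 1) → ℝ))
    (sp : (j : ℕ) → (domSys (F.P K) M j).Dom → Set (CPair (F.P K) 𝔸)) {ρ A R r₁ E₀ : ℝ} (hρ : 0 < ρ)
    (hW : ∀ k, ∀ g ∈ W, restrictPrefix k g ∈ Wk k) (hrestr : ∀ k, W1.SpRestr (sp (k + 1)))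
    (hstep : ∀ k : ℕ,
      (∀ g ∈ W, ∀ j ≤ k, ∀ (X : (domSys (F.P K) M j).Dom), ∀ φ ∈ thickening ρ (sp j X),
          ‖termC S j X g φ‖ ≤ E₀ * Real.exp (-(r₁ * (domSys (F.P K) M j).dj X))) →
      (∀ g ∈ W, ∀ j ≤ k, ∀ (X : (domSys (F.P K) M j).Dom), AnalyticOnNhd ℂ (termC S j X g) (thickening ρ (sp j X))) →
      (S k).AnalyticH (Wk k) (fun X => thickening ρ (sp (k + 1) X)) ∧
        (S k).Bound238 (Wk k) (fun X => thickening ρ (sp (k + 1) X)) A R)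
    (hA : 0 ≤ A) (hr₁ : 0 ≤ r₁) (hrate : r₁ + 2 * (64 * Real.log 162) + 2 ≤ R)
    (hsmall : A * Real.exp (5 * r₁ + 1) * K₀ 64 8 * 9 * 64 < 1) (hrenew : Real.exp 1 * 9 * 64 * K₀ 64 8 ^ 2 * A ≤ E₀) :
    TermDerivBound S W sp (Real.exp 1 * 9 * 64 * K₀ 64 8 ^ 2 * A / ρ) r₁ :=
  have hall := hLayer_all_of_inductiveStep F K S W Wk (fun j X => thickening ρ (sp j X)) hW
    (fun k => spRestr_thickening (hrestr k) ρ) hstep hA hr₁ hrate hsmall hrenew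
  termDerivBound_of_bound238_thickening F K S W Wk sp hρ hW hrestr (fun k => (hall k).1) (fun k => (hall k).2) hA hr₁ hrate hsmall.le

end Seventeen

/-! ## §3 L05 ∕ L06 from (STEP): at any level pairing, and AT THE ADMISSIBLE PAIRING OF RECORD with no embedding clause -/

section Reading

variable {F : T4Family} {𝔸 : Type*} [NormedRing 𝔸] [NormedAlgebra ℂ 𝔸] {M k : ℕ} (R : LevelPairing F 𝔸 M k)

open Classical in
/-- **L05 AT A LEVEL PAIRING FROM (STEP)** — `DecayBound (R.EA S) (Window γ) (e·9·64·K₀(64,8)²·A) r₁`: run A's tower `S` on `F.P k`, a restriction-closed table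
`sp` holding the readings `R.embA U` (`hembA`, DISPLAYED as in file 10), (STEP) for the window `]0, γ]` and the boxes `]0, γ]^{m+1}`, the located clauses
and the renewal; §1's `hLayer_all_of_inductiveStep` feeds file 10's `decayBound_EA_of_bound238_table`. [cite: Balaban1987RG1, (0.25) p.257, (1.18) p.263 and Thm 1 p.259; Balaban1988RG2Cluster, Lemma 3 (2.38) p.20 and (2.41) p.21] -/
theorem decayBound_EA_of_inductiveStep (S : ClusterTower (F.P k) 𝔸 M)
    (sp : (j : ℕ) → (domSys (F.P k) M j).Dom → Set (CPair (F.P k) 𝔸)) {γ A Rr r₁ E₀ : ℝ}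
    (hembA : ∀ (j : ℕ) (U : R.BgA) (X : (domSys (F.P k) M j).Dom), R.embA U ∈ sp j X)
    (hrestr : ∀ m, W1.SpRestr (sp (m + 1)))
    (hstep : ∀ m : ℕ,
      (∀ g ∈ Window γ, ∀ j ≤ m, ∀ (X : (domSys (F.P k) M j).Dom), ∀ φ ∈ sp j X,
          ‖termC S j X g φ‖ ≤ E₀ * Real.exp (-(r₁ * (domSys (F.P k) M j).dj X))) →
      (∀ g ∈ Window γ, ∀ j ≤ m, ∀ (X : (domSys (F.P k) M j).Dom), AnalyticOnNhd ℂ (termC S j X g) (sp j X)) →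
      (S m).AnalyticH (box γ m) (sp (m + 1)) ∧ (S m).Bound238 (box γ m) (sp (m + 1)) A Rr)
    (hA : 0 ≤ A) (hr₁ : 0 ≤ r₁) (hrate : r₁ + 2 * (64 * Real.log 162) + 2 ≤ Rr)
    (hsmall : A * Real.exp (5 * r₁ + 1) * K₀ 64 8 * 9 * 64 < 1) (hrenew : Real.exp 1 * 9 * 64 * K₀ 64 8 ^ 2 * A ≤ E₀) :
    DecayBound (R.EA S) (Window γ) (Real.exp 1 * 9 * 64 * K₀ 64 8 ^ 2 * A) r₁ :=
  have hall := hLayer_all_of_inductiveStep F k S (Window γ) (fun m => box γ m) sp (fun m _ hg => restrictPrefix_mem_box hg m) hrestr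
    hstep hA hr₁ hrate hsmall hrenew
  decayBound_EA_of_bound238_table R S sp hembA hrestr (fun m => (hall m).1) (fun m => (hall m).2) hA hr₁ hrate hsmall

open Classical in
/-- **L06 AT A LEVEL PAIRING FROM (STEP)** — `DecayBound (R.EB S′ b) (Window γ) (e·9·64·K₀(64,8)²·A) r₁` for `b ∈ ]0, γ]`: run B's tower `S′` on `F.P (k+1)`,
a restriction-closed table `sp′` holding the readings `R.embB U` (`hembB`), the pairing clause `hpair` (DISPLAYED; an equality at the pairing of record),
(STEP) for run B, the clauses and the renewal; §1 feeds file 10's `decayBound_EB_of_bound238_table`. [cite: Balaban1987RG1, (0.24)-(0.25) p.257, (1.18) p.263 and Thm 1 p.259; Balaban1988RG2Cluster, Lemma 3 (2.38) p.20 and (2.41) p.21] -/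
theorem decayBound_EB_of_inductiveStep (S' : ClusterTower (F.P (k + 1)) 𝔸 M)
    (sp' : (j : ℕ) → (domSys (F.P (k + 1)) M j).Dom → Set (CPair (F.P (k + 1)) 𝔸)) {γ A Rr r₁ E₀ : ℝ}
    (hembB : ∀ (j : ℕ) (U : R.BgB) (Y : (domSys (F.P (k + 1)) M j).Dom), R.embB U ∈ sp' j Y)
    (hpair : ∀ X : W1.Dom (F.P k) M,
      (domSys (F.P k) M X.1).dj X.2 ≤ (domSys (F.P (k + 1)) M (R.pair X).1).dj (R.pair X).2)
    (hrestr : ∀ m, W1.SpRestr (sp' (m + 1)))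
    (hstep : ∀ m : ℕ,
      (∀ g ∈ Window γ, ∀ j ≤ m, ∀ (Y : (domSys (F.P (k + 1)) M j).Dom), ∀ φ ∈ sp' j Y,
          ‖termC S' j Y g φ‖ ≤ E₀ * Real.exp (-(r₁ * (domSys (F.P (k + 1)) M j).dj Y))) →
      (∀ g ∈ Window γ, ∀ j ≤ m, ∀ (Y : (domSys (F.P (k + 1)) M j).Dom), AnalyticOnNhd ℂ (termC S' j Y g) (sp' j Y)) →
      (S' m).AnalyticH (box γ m) (sp' (m + 1)) ∧ (S' m).Bound238 (box γ m) (sp' (m + 1)) A Rr)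
    (hA : 0 ≤ A) (hr₁ : 0 ≤ r₁) (hrate : r₁ + 2 * (64 * Real.log 162) + 2 ≤ Rr)
    (hsmall : A * Real.exp (5 * r₁ + 1) * K₀ 64 8 * 9 * 64 < 1) (hrenew : Real.exp 1 * 9 * 64 * K₀ 64 8 ^ 2 * A ≤ E₀) {b : ℝ}
    (hb : b ∈ Ioc (0 : ℝ) γ) :
    DecayBound (R.EB S' b) (Window γ) (Real.exp 1 * 9 * 64 * K₀ 64 8 ^ 2 * A) r₁ :=
  have hall := hLayer_all_of_inductiveStep F (k + 1) S' (Window γ) (fun m => box γ m) sp' (fun m _ hg => restrictPrefix_mem_box hg m)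
    hrestr hstep hA hr₁ hrate hsmall hrenew
  decayBound_EB_of_bound238_table R S' sp' hembB hpair hrestr (fun m => (hall m).1) (fun m => (hall m).2) hA hr₁ hrate hsmall hb

end Reading

section Admissible

open scoped Matrix.Norms.L2Operator

variable (F : T4Family) (M N k : ℕ) (sp : (k j : ℕ) → (domSys (F.P k) M j).Dom → Set (CPair (F.P k) (MatA N)))
  (gauge : GaugeField (F.P k) 0 (Node00.SU N) → GaugeField (F.P k) 0 (Node00.SU N) → ℝ) (hg : ∀ U U', 0 ≤ gauge U U')
  (T₀ : GaugeField (F.P (k + 1)) 0 (Node00.SU N) → GaugeField (F.P k) 0 (Node00.SU N))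
  (hT₀ : ∀ U : GaugeField (F.P (k + 1)) 0 (Node00.SU N),
    (∀ (j : ℕ) (Y : (domSys (F.P (k + 1)) M j).Dom), ofBackgroundC (ιSU N) U ∈ sp (k + 1) j Y) →
      ∀ (j : ℕ) (Y : (domSys (F.P k) M j).Dom), ofBackgroundC (ιSU N) (T₀ U) ∈ sp k j Y)

open Classical in
/-- **★ L05 AT THE ADMISSIBLE PAIRING OF RECORD FROM (STEP) — NO EMBEDDING CLAUSE, NO UNCONDITIONAL PER-STEP DATA.**  At `LevelPairing.ofRecordAdm F M N k sp
gauge hg T₀ hT₀` (run A = the admissible `SU(N)` backgrounds of `F.P k` for the table family `sp`, readings `(ιU, 0)` IN THE SPACES BY TYPE —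
`LevelPairing.ofRecordAdm_embA_mem`): (STEP) for run A's tower `S` on the tables `sp k`, their restriction property, the located clauses and the renewal ⟹
`DecayBound ((LevelPairing.ofRecordAdm …).EA S) (Window γ) (e·9·64·K₀(64,8)²·A) r₁` — [I] (1.18) read at the admissible backgrounds, i.e. leaf L05 of the
END at the admissible reading, from the ONE displayed step. [cite: Balaban1987RG1, (0.25) p.257, (1.18) p.263 («for all configurations (𝐔,𝐉) ∈ U^c_j») and Thm 1 p.259; Balaban1988RG2Cluster, p.22] -/
theorem decayBound_EA_ofRecordAdm_of_inductiveStep (S : ClusterTower (F.P k) (MatA N) M) {γ A Rr r₁ E₀ : ℝ}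
    (hrestr : ∀ m, W1.SpRestr (sp k (m + 1)))
    (hstep : ∀ m : ℕ,
      (∀ g ∈ Window γ, ∀ j ≤ m, ∀ (X : (domSys (F.P k) M j).Dom), ∀ φ ∈ sp k j X,
          ‖termC S j X g φ‖ ≤ E₀ * Real.exp (-(r₁ * (domSys (F.P k) M j).dj X))) →
      (∀ g ∈ Window γ, ∀ j ≤ m, ∀ (X : (domSys (F.P k) M j).Dom), AnalyticOnNhd ℂ (termC S j X g) (sp k j X)) →
      (S m).AnalyticH (box γ m) (sp k (m + 1)) ∧ (S m).Bound238 (box γ m) (sp k (m + 1)) A Rr)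
    (hA : 0 ≤ A) (hr₁ : 0 ≤ r₁) (hrate : r₁ + 2 * (64 * Real.log 162) + 2 ≤ Rr)
    (hsmall : A * Real.exp (5 * r₁ + 1) * K₀ 64 8 * 9 * 64 < 1) (hrenew : Real.exp 1 * 9 * 64 * K₀ 64 8 ^ 2 * A ≤ E₀) :
    DecayBound ((LevelPairing.ofRecordAdm F M N k sp gauge hg T₀ hT₀).EA S) (Window γ) (Real.exp 1 * 9 * 64 * K₀ 64 8 ^ 2 * A) r₁ :=
  decayBound_EA_of_inductiveStep (LevelPairing.ofRecordAdm F M N k sp gauge hg T₀ hT₀) S (sp k)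
    (fun j U X => LevelPairing.ofRecordAdm_embA_mem F M N k sp gauge hg T₀ hT₀ U j X) hrestr hstep hA hr₁ hrate hsmall hrenew

open Classical in
/-- **★ L06 AT THE ADMISSIBLE PAIRING OF RECORD FROM (STEP) — NO EMBEDDING CLAUSE, NO PAIRING CLAUSE.**  Run B = the admissible backgrounds of `F.P (k+1)` (readings
in the spaces BY TYPE, `LevelPairing.ofRecordAdm_embB_mem`), the domain pairing IS `W1.pairOfRecord`, which PRESERVES `d_j` (`W1.dj_pairOfRecord`): (STEP)
for run B's tower `S′` on the tables `sp (k+1)`, their restriction property, the clauses and the renewal ⟹ for every member `b ∈ ]0, γ]`,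
`DecayBound ((LevelPairing.ofRecordAdm …).EB S′ b) (Window γ) (e·9·64·K₀(64,8)²·A) r₁` — leaf L06 of the END at the admissible reading.
[cite: Balaban1987RG1, (0.24)-(0.25) p.257, (1.18) p.263 and Thm 1 p.259; Balaban1988RG2Cluster, p.22] -/
theorem decayBound_EB_ofRecordAdm_of_inductiveStep (S' : ClusterTower (F.P (k + 1)) (MatA N) M) {γ A Rr r₁ E₀ : ℝ}
    (hrestr : ∀ m, W1.SpRestr (sp (k + 1) (m + 1)))
    (hstep : ∀ m : ℕ,
      (∀ g ∈ Window γ, ∀ j ≤ m, ∀ (Y : (domSys (F.P (k + 1)) M j).Dom), ∀ φ ∈ sp (k + 1) j Y,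
          ‖termC S' j Y g φ‖ ≤ E₀ * Real.exp (-(r₁ * (domSys (F.P (k + 1)) M j).dj Y))) →
      (∀ g ∈ Window γ, ∀ j ≤ m, ∀ (Y : (domSys (F.P (k + 1)) M j).Dom), AnalyticOnNhd ℂ (termC S' j Y g) (sp (k + 1) j Y)) →
      (S' m).AnalyticH (box γ m) (sp (k + 1) (m + 1)) ∧ (S' m).Bound238 (box γ m) (sp (k + 1) (m + 1)) A Rr)
    (hA : 0 ≤ A) (hr₁ : 0 ≤ r₁) (hrate : r₁ + 2 * (64 * Real.log 162) + 2 ≤ Rr)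
    (hsmall : A * Real.exp (5 * r₁ + 1) * K₀ 64 8 * 9 * 64 < 1) (hrenew : Real.exp 1 * 9 * 64 * K₀ 64 8 ^ 2 * A ≤ E₀) {b : ℝ}
    (hb : b ∈ Ioc (0 : ℝ) γ) :
    DecayBound ((LevelPairing.ofRecordAdm F M N k sp gauge hg T₀ hT₀).EB S' b) (Window γ) (Real.exp 1 * 9 * 64 * K₀ 64 8 ^ 2 * A) r₁ :=
  decayBound_EB_of_inductiveStep (LevelPairing.ofRecordAdm F M N k sp gauge hg T₀ hT₀) S' (sp (k + 1))
    (fun j U Y => LevelPairing.ofRecordAdm_embB_mem F M N k sp gauge hg T₀ hT₀ U j Y)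
    (fun X => (dj_pairOfRecord F M k X).symm.le) hrestr hstep hA hr₁ hrate hsmall hrenew hb

end Admissible

/-! ## §4 Riders: file 10's unconditional data give (STEP); (STEP) is satisfiable (A5) -/

section Riders

variable {P : Params} {𝔸 : Type*} [NormedRing 𝔸] [NormedAlgebra ℂ 𝔸] {M : ℕ}

omit [NormedRing 𝔸] [NormedAlgebra ℂ 𝔸] in
/-- **FILE 10's UNCONDITIONAL PER-STEP DATA GIVE (STEP)** (so §1 GENERALISES `termBound118_of_bound238_table` ∕ `termAnalytic_of_bound238_table`: their
hypotheses `han ∕ h238 : ∀ k, …` are the antecedent-free case of the schema). [cite: Balaban1988RG2Cluster, p.15 (analyticity statement) and Lemma 3 (2.38) p.20] -/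
theorem inductiveStep_of_unconditional [NormedRing 𝔸] [NormedAlgebra ℂ 𝔸] (S : ClusterTower P 𝔸 M) (W : Set (ℕ → ℝ))
    (Wk : (k : ℕ) → Set (Fin (k + 1) → ℝ)) (sp : (j : ℕ) → (domSys P M j).Dom → Set (CPair P 𝔸)) {A R r₁ E₀ : ℝ}
    (han : ∀ k, (S k).AnalyticH (Wk k) (sp (k + 1))) (h238 : ∀ k, (S k).Bound238 (Wk k) (sp (k + 1)) A R) :
    ∀ k : ℕ,
      (∀ g ∈ W, ∀ j ≤ k, ∀ (X : (domSys P M j).Dom), ∀ φ ∈ sp j X,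
          ‖termC S j X g φ‖ ≤ E₀ * Real.exp (-(r₁ * (domSys P M j).dj X))) →
      (∀ g ∈ W, ∀ j ≤ k, ∀ (X : (domSys P M j).Dom), AnalyticOnNhd ℂ (termC S j X g) (sp j X)) →
      (S k).AnalyticH (Wk k) (sp (k + 1)) ∧ (S k).Bound238 (Wk k) (sp (k + 1)) A R :=
  fun k _ _ => ⟨han k, h238 k⟩

/-- **(STEP) IS SATISFIABLE (A5 rider)**: W1's termless MODEL tower (`idx Z = ∅`, `H ≡ 0`; `RateRecordW1Reading` §6) carries the schema for every `A ≥ 0`, every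
rate and every antecedent (file 9's `analyticH_termlessTower` ∕ `bound238_termlessTower`) — so §1–§3 are not vacuous implications.  A junk-shaped witness,
labelled so: NOT NODE 00's towers (ref-H WATCH-W1-DEGENERATE — content lives only in towers pinned to the (2.14) terms of record). [folklore] -/
theorem inductiveStep_termlessTower (W : Set (ℕ → ℝ)) (Wk : (k : ℕ) → Set (Fin (k + 1) → ℝ))
    (sp : (j : ℕ) → (domSys P M j).Dom → Set (CPair P 𝔸)) {A R r₁ E₀ : ℝ} (hA : 0 ≤ A) :
    ∀ k : ℕ,
      (∀ g ∈ W, ∀ j ≤ k, ∀ (X : (domSys P M j).Dom), ∀ φ ∈ sp j X,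
          ‖termC (termlessTower P 𝔸 M) j X g φ‖ ≤ E₀ * Real.exp (-(r₁ * (domSys P M j).dj X))) →
      (∀ g ∈ W, ∀ j ≤ k, ∀ (X : (domSys P M j).Dom), AnalyticOnNhd ℂ (termC (termlessTower P 𝔸 M) j X g) (sp j X)) →
      (termlessTower P 𝔸 M k).AnalyticH (Wk k) (sp (k + 1)) ∧ (termlessTower P 𝔸 M k).Bound238 (Wk k) (sp (k + 1)) A R :=
  fun k _ _ => ⟨analyticH_termlessTower k (Wk k) (sp (k + 1)), bound238_termlessTower k (Wk k) (sp (k + 1)) hA⟩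

end Riders

end Summit.QuantumFields.YangMills.BalabanUVNodes.N18HLayerW1Induction

end
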